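/-
Origin: expansion seat `planner-pub-hodgecm-pv14-g4-0`, handover #2 2026-08-18T08:29:38Z (`HOME/pub-hodgecm-pv14-g4/lean/Pv14g4/WeilThetaModelSchrodinger.lean`, md5 3c1cc57a, 327 lines);
landed by the gen-7 packager in gate run 27 as `HodgeCM/Automorphic/WeilThetaModelSchrodinger.lean` (import ^import Pv14g4\.→import HodgeCM.Automorphic. ×1).
-/
/-
Origin: HOME/pub-hodgecm-pv14-g4/lean/Pv14g4/WeilThetaModelSchrodinger.lean — session planner-pub-hodgecm-pv14-g4-0
(unit pub-hodgecm-pv14-g4, DAG-NODE PROVER #14 gen 4; lineage pv14 → pv14-g2 → pv14-g3 → pv14-g4).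
Intended final place (packager's call): `HodgeCM/Automorphic/WeilThetaModelSchrodinger.lean`.
NEW ADDITIVE LEAF.  WIP import ↦ landed name: `Pv14g4.SchwartzTranslation` ↦ `HodgeCM.Automorphic.SchwartzTranslation`
(my HANDOVER #1, same run; lands AFTER it); the other imports are landed tree modules (`HodgeCM.Automorphic.WeilThetaModel`,
prl1-g4 run 25) + Mathlib.
KIND: KERNEL + HONEST MODEL — nothing cited, nothing posited: an INHABITANT of `HodgeCM.WeilThetaModel` in which every
labelled field (P / PRINT-BY-NAME / PRINT-DERIVED / class-U / DEF) is a THEOREM or an explicit construction.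
-/
import Summits.HodgeConjecture.HodgeCM.Automorphic.SchwartzTranslation
import Summits.HodgeConjecture.HodgeCM.Automorphic.WeilThetaModel
import Mathlib.Analysis.Complex.Circle
import Mathlib.Analysis.Calculus.BumpFunction.FiniteDimension

/-!
# The archimedean Schrödinger–lattice inhabitant of `WeilThetaModel`

prl1-g4's record `HodgeCM.WeilThetaModel GU ΓU G Γ` (`HodgeCM/Automorphic/WeilThetaModel.lean`, run 25) packages
Weil's adelic theta machine as DATA with LABELLED hypotheses: a `Literature.Theta.WeilThetaDatum`
`(Mp(X)_A, S(X_A), act, r_k(Ps_k), Θ)` [We64 n° 37–41] + `act_one` [P] + `theta_act` [DEF n° 41 + P n° 37] +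
`actionContinuous` [PRINT BY NAME, We64 n° 39] + `thetaContinuousInvariant` [PRINT BY NAME, We64 Thm 6] +
`dist_cont` [PRINT-DERIVED, We64 p. 194 / PerL v5 l. 343 — the one field GAPS prl1g4-K1 flags as NOT print by name] +
the dual-pair splitting `s` [class U] + the index space `SK` [DEF].  From these prl1-g4 PROVES the three structural
laws of the kernel-model theta carrier (`omg_one`, `θ_cont`, `θ_omg`).

This file shows the labelled field set is HONESTLY and NON-DEGENERATELY satisfiable, with ZERO cited facts, by the
genuine theta series of a lattice at the archimedean place — the rank-one real-place shadow of Weil's machine: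

* `E` a finite-dimensional real normed space, `L ⊆ E` a discrete `ℤ`-lattice (`X_k ↦ L`, `X_A ↦ E`);
* `S(X_A) ↦ 𝓢(E, ℂ)` (Mathlib's Schwartz space);
* `Mp(X)_A ↦ Multiplicative E × Circle`: the commuting pair (Heisenberg TRANSLATIONS by `E`) × (the compact torus
  `U(1)` acting through the weight-`m` character `u ↦ u ^ m`) — the dictionary image of the dual pair
  `G_U(𝔸) × U(W_i)(𝔸)` with `U(W_i)(ℝ) = U(1)` acting on the type-`m_i` vectors by a character (PerL v5 l. 300);
* `act (a, u) Φ = u ^ m • Φ (· - a)`;  `r_k(Ps_k) ↦ rat = {(a, u) | a ∈ L, u ^ m = 1}`;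
* `Θ_Φ(S) = Σ_{ξ ∈ X_k} (SΦ)(ξ) ↦ theta Φ S = ∑' v : L, (act S Φ) v` — LITERALLY Weil's formula [n° 41 p. 193].

THEOREMS (Mathlib only; the analysis is `SchwartzTranslation`):
`act_one`, `act_mul`, `theta_act`; **`actionContinuous`** (n° 39: joint continuity of `(S, Φ) ↦ SΦ` — joint
continuity of translation on the Schwartz space); **`continuous_theta_uncurry`** (joint continuity of
`(Φ, S) ↦ Θ_Φ(S)`, hence Thm 6's continuity in `S` AND `dist_cont` in `Φ` — the theta distribution is the
continuous linear functional `SchwartzWeil.thetaCLM`); **`theta_rat_mul`** (Thm 6's left invariance under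
`r_k(Ps_k)` = `L`-periodicity of the lattice sum); `thetaContinuousInvariant`; non-degeneracy **`exists_theta_ne_zero`**
(`Θ` is not identically zero, so the invariance is not vacuous).  Then **`schrodingerModel`** is a term of type
`HodgeCM.WeilThetaModel (Multiplicative E) (latticeSubgroup L) Circle Γ` for every `Γ ≤ {u | u ^ m = 1}` (e.g. `⊥`),
with `s := MonoidHom.id`, `SK := univ`; prl1-g4's `θ_cont`, `θ_omg`, `omg_one`, `structural_laws` apply to it BY NAME
(`schrodingerModel_structural_laws`).

WHAT THIS IS: a consistency / non-vacuity witness for the `WeilThetaModel` interface (cf. pv08-g5's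
`Model/Toy/SeesawSchwartzModel` for the S5 shell), and the kernel content of `dist_cont` in the archimedean dictionary.
WHAT THIS IS NOT: not the adelic Schwartz–Bruhat space, not the metaplectic group, not a discharge of any DATA field of
`Universe.WeilModelThetaData` for the PerL contexts — DIVERGENCE.md stands: no adelic Weil representation is constructed.
-/

set_option autoImplicit false

noncomputable section

open Filter Topology Set
open scoped SchwartzMap

namespace HodgeCM
namespace SchwartzWeil

variable (E : Type) [NormedAddCommGroup E] [NormedSpace ℝ E] [FiniteDimensional ℝ E]
  (L : Submodule ℤ E) [DiscreteTopology L] (m : ℤ)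

/-! ## 1. The Schrödinger–lattice action of `Multiplicative E × Circle` on `𝓢(E, ℂ)` -/

/-- `(a, u) • Φ := u ^ m • Φ (· - a)`: Heisenberg translation by `a ∈ E` and the weight-`m` character of `U(1)`. -/
def act (S : Multiplicative E × Circle) (Φ : 𝓢(E, ℂ)) : 𝓢(E, ℂ) :=
  ((S.2 ^ m : Circle) : ℂ) • SchwartzMap.compSubConstCLM ℂ (Multiplicative.toAdd S.1) Φ

omit [FiniteDimensional ℝ E] in
/-- (Ported verbatim from the HodgeCMPerL package; no docstring in the source.) -/
@[simp] theorem act_apply (S : Multiplicative E × Circle) (Φ : 𝓢(E, ℂ)) (x : E) :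
    act E m S Φ x = ((S.2 : ℂ) ^ m) * Φ (x - Multiplicative.toAdd S.1) := by
  simp [act, smul_eq_mul]

omit [FiniteDimensional ℝ E] in
/-- P: the unit acts trivially. -/
theorem act_one (Φ : 𝓢(E, ℂ)) : act E m 1 Φ = Φ := by
  ext x
  simp

omit [FiniteDimensional ℝ E] in
/-- P [n° 37]: `(SS')Φ = S(S'Φ)` — the action is a genuine left action (translations commute, characters multiply). -/
theorem act_mul (S S' : Multiplicative E × Circle) (Φ : 𝓢(E, ℂ)) :
    act E m (S * S') Φ = act E m S (act E m S' Φ) := by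
  ext x
  simp only [act_apply, Prod.snd_mul, Prod.fst_mul, Circle.coe_mul, toAdd_mul, mul_zpow]
  rw [show x - (Multiplicative.toAdd S.1 + Multiplicative.toAdd S'.1) =
      x - Multiplicative.toAdd S.1 - Multiplicative.toAdd S'.1 from by abel]
  ring

omit [FiniteDimensional ℝ E] in
/-- **n° 39 in the model (THEOREM): `(S, Φ) ↦ SΦ` is jointly continuous** — joint continuity of translation on the
Schwartz space (`SchwartzWeil.continuous_compSubConstCLM_uncurry`) and of the scalar action. -/
theorem continuous_act_uncurry :
    Continuous (Function.uncurry (act E m)) := by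
  have hc : Continuous fun p : (Multiplicative E × Circle) × 𝓢(E, ℂ) => ((p.1.2 ^ m : Circle) : ℂ) :=
    continuous_subtype_val.comp ((continuous_zpow (G := Circle) m).comp (continuous_snd.comp continuous_fst))
  have hτ : Continuous fun p : (Multiplicative E × Circle) × 𝓢(E, ℂ) =>
      SchwartzMap.compSubConstCLM ℂ (Multiplicative.toAdd p.1.1) p.2 :=
    (continuous_compSubConstCLM_uncurry ℂ).comp
      ((continuous_toAdd.comp (continuous_fst.comp continuous_fst)).prodMk continuous_snd)
  exact hc.smul hτ

/-! ## 2. Weil's theta series `Θ_Φ(S) = Σ_{ξ ∈ X_k} (SΦ)(ξ)` -/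

/-- `Θ_Φ(S) := ∑_{v ∈ L} (S • Φ)(v)` — literally [We64 n° 41 p. 193]. -/
def theta (Φ : 𝓢(E, ℂ)) (S : Multiplicative E × Circle) : ℂ :=
  ∑' v : L, act E m S Φ (v : E)

/-- `Θ` through the theta DISTRIBUTION: `Θ_Φ(S) = thetaCLM L 0 (S • Φ)`. -/
theorem theta_eq_thetaCLM (Φ : 𝓢(E, ℂ)) (S : Multiplicative E × Circle) :
    theta E L m Φ S = thetaCLM L 0 (act E m S Φ) := by
  simp only [theta, thetaCLM_apply, zero_add]

omit [FiniteDimensional ℝ E] [DiscreteTopology L] in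
/-- Closed form: `Θ_Φ(a, u) = u ^ m · ∑_{v ∈ L} Φ (-a + v)`. -/
theorem theta_eq (Φ : 𝓢(E, ℂ)) (S : Multiplicative E × Circle) :
    theta E L m Φ S = ((S.2 : ℂ) ^ m) * ∑' v : L, Φ (-Multiplicative.toAdd S.1 + (v : E)) := by
  simp only [theta, act_apply, tsum_mul_left, sub_eq_neg_add]

omit [FiniteDimensional ℝ E] [DiscreteTopology L] in
/-- DEF [n° 41] + P [n° 37]: `Θ_{S'Φ}(S) = Θ_Φ(SS')`. -/
theorem theta_act (Φ : 𝓢(E, ℂ)) (S S' : Multiplicative E × Circle) :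
    theta E L m (act E m S' Φ) S = theta E L m Φ (S * S') := by
  simp only [theta, act_mul]

/-- **Joint continuity of `(Φ, S) ↦ Θ_Φ(S)` (THEOREM)** — the theta distribution is a continuous linear functional
(`thetaCLM`) and the action is jointly continuous. -/
theorem continuous_theta_uncurry :
    Continuous fun p : 𝓢(E, ℂ) × (Multiplicative E × Circle) => theta E L m p.1 p.2 := by
  simp only [theta_eq_thetaCLM]
  exact (thetaCLM L (0 : E)).continuous.comp
    ((continuous_act_uncurry E m).comp (continuous_snd.prodMk continuous_fst))

/-- **Thm 6, first half, in the model (THEOREM)**: `S ↦ Θ_Φ(S)` is continuous. -/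
theorem continuous_theta (Φ : 𝓢(E, ℂ)) : Continuous (theta E L m Φ) :=
  (continuous_theta_uncurry E L m).comp (Continuous.prodMk_right Φ)

/-- **`dist_cont` in the model (THEOREM)**: the theta distribution `Φ ↦ Θ_Φ(1)` is continuous (indeed
`Φ ↦ Θ_Φ(S)` for every `S`). -/
theorem continuous_theta_left (S : Multiplicative E × Circle) : Continuous fun Φ : 𝓢(E, ℂ) => theta E L m Φ S :=
  (continuous_theta_uncurry E L m).comp (Continuous.prodMk_left S)

/-- `r_k(Ps_k)` in the model: lattice translations and `m`-torsion phases. -/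
def rat : Set (Multiplicative E × Circle) :=
  {S | Multiplicative.toAdd S.1 ∈ L ∧ S.2 ^ m = 1}

omit [NormedSpace ℝ E] [FiniteDimensional ℝ E] [DiscreteTopology L] in
/-- (Ported verbatim from the HodgeCMPerL package; no docstring in the source.) -/
@[simp] theorem mem_rat (S : Multiplicative E × Circle) :
    S ∈ rat E L m ↔ Multiplicative.toAdd S.1 ∈ L ∧ S.2 ^ m = 1 := Iff.rfl

omit [FiniteDimensional ℝ E] [DiscreteTopology L] in
/-- **Thm 6, second half, in the model (THEOREM)**: `Θ_Φ(γS) = Θ_Φ(S)` for `γ ∈ r_k(Ps_k)` — `L`-periodicity of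
the lattice sum (pv11-g2 `LatticeTheta.tsum_translate_add_mem`) and `γ.2 ^ m = 1`. -/
theorem theta_rat_mul (Φ : 𝓢(E, ℂ)) {γ : Multiplicative E × Circle} (hγ : γ ∈ rat E L m)
    (S : Multiplicative E × Circle) : theta E L m Φ (γ * S) = theta E L m Φ S := by
  obtain ⟨hγ1, hγ2⟩ := hγ
  rw [theta_eq, theta_eq]
  simp only [Prod.snd_mul, Prod.fst_mul, Circle.coe_mul, toAdd_mul, mul_zpow]
  rw [← Circle.coe_zpow γ.2, hγ2, Circle.coe_one, one_mul]
  congr 1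
  have hw : -(Multiplicative.toAdd γ.1 + Multiplicative.toAdd S.1) =
      -Multiplicative.toAdd S.1 + ((-(⟨Multiplicative.toAdd γ.1, hγ1⟩ : L) : L) : E) := by
    simp only [Submodule.coe_neg]; abel
  rw [hw]
  exact PerL34.LatticeTheta.tsum_translate_add_mem L Φ _ _

/-! ## 3. Non-degeneracy: `Θ` is not identically zero -/

omit [NormedSpace ℝ E] [FiniteDimensional ℝ E] in
/-- A discrete lattice is uniformly isolated at `0`: `‖v‖ < ε ⇒ v = 0` for some `ε > 0`. -/
theorem exists_norm_lt_imp_eq_zero : ∃ ε : ℝ, 0 < ε ∧ ∀ v : L, ‖(v : E)‖ < ε → v = 0 := by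
  have hopen : IsOpen ({0} : Set L) := isOpen_discrete _
  obtain ⟨ε, hε, hball⟩ := Metric.isOpen_iff.1 hopen 0 (Set.mem_singleton 0)
  refine ⟨ε, hε, fun v hv => ?_⟩
  have hv' : v ∈ Metric.ball (0 : L) ε := by
    rw [Metric.mem_ball, dist_zero_right]
    simpa only [Submodule.coe_norm] using hv
  exact hball hv'

/-- A complex-valued Schwartz (bump) function equal to `1` at `0` and vanishing at every non-zero lattice point. -/
theorem exists_schwartz_bump :
    ∃ f : 𝓢(E, ℂ), f 0 = 1 ∧ ∀ v : L, v ≠ 0 → f (v : E) = 0 := by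
  obtain ⟨ε, hε, hiso⟩ := exists_norm_lt_imp_eq_zero E L
  let φ : ContDiffBump (0 : E) := ⟨ε / 2, ε, by positivity, by linarith⟩
  have hs : HasCompactSupport (Complex.ofReal ∘ φ) := φ.hasCompactSupport.comp_left Complex.ofReal_zero
  have hd : ContDiff ℝ ((⊤ : ℕ∞) : WithTop ℕ∞) (Complex.ofReal ∘ φ) :=
    Complex.ofRealCLM.contDiff.comp φ.contDiff
  refine ⟨hs.toSchwartzMap hd, ?_, fun v hv => ?_⟩
  · show ((φ 0 : ℝ) : ℂ) = 1
    rw [φ.one_of_mem_closedBall (Metric.mem_closedBall_self (by positivity))]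
    simp
  · show ((φ (v : E) : ℝ) : ℂ) = 0
    have hfar : φ.rOut ≤ dist (v : E) 0 := by
      rw [dist_zero_right]
      by_contra h
      exact hv (hiso v (lt_of_not_ge h))
    rw [φ.zero_of_le_dist hfar]
    simp

/-- **Non-degeneracy (THEOREM)**: `Θ_Φ(1) = 1` for a suitable bump `Φ` — so Thm 6's invariance and `dist_cont` are
statements about a non-zero theta function. -/
theorem exists_theta_one_eq_one : ∃ Φ : 𝓢(E, ℂ), theta E L m Φ 1 = 1 := by
  obtain ⟨f, hf0, hfv⟩ := exists_schwartz_bump E L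
  refine ⟨f, ?_⟩
  rw [theta_eq]
  simp only [Prod.snd_one, Circle.coe_one, one_zpow, Prod.fst_one, toAdd_one, neg_zero, zero_add, one_mul]
  rw [tsum_eq_single (0 : L) (fun v hv => hfv v hv)]
  simpa using hf0

/-- (Ported verbatim from the HodgeCMPerL package; no docstring in the source.) -/
theorem exists_theta_ne_zero : ∃ (Φ : 𝓢(E, ℂ)) (S : Multiplicative E × Circle), theta E L m Φ S ≠ 0 := by
  obtain ⟨Φ, hΦ⟩ := exists_theta_one_eq_one E L m
  exact ⟨Φ, 1, by rw [hΦ]; exact one_ne_zero⟩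

/-! ## 4. The Weil theta DATUM and the Weil theta MODEL -/

/-- **The archimedean Schrödinger–lattice Weil theta datum** `(Mp, S, act, r_k(Ps_k), Θ)`. -/
def datum : Literature.Theta.WeilThetaDatum.{0} where
  Mp := Multiplicative E × Circle
  SX := 𝓢(E, ℂ)
  act := act E m
  rat := rat E L m
  theta := theta E L m

omit [FiniteDimensional ℝ E] [DiscreteTopology L] in
/-- (Ported verbatim from the HodgeCMPerL package; no docstring in the source.) -/
@[simp] theorem datum_Mp : (datum E L m).Mp = (Multiplicative E × Circle) := rfl
omit [FiniteDimensional ℝ E] [DiscreteTopology L] in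
/-- (Ported verbatim from the HodgeCMPerL package; no docstring in the source.) -/
@[simp] theorem datum_SX : (datum E L m).SX = 𝓢(E, ℂ) := rfl
omit [FiniteDimensional ℝ E] [DiscreteTopology L] in
/-- (Ported verbatim from the HodgeCMPerL package; no docstring in the source.) -/
theorem datum_act : (datum E L m).act = act E m := rfl
omit [FiniteDimensional ℝ E] [DiscreteTopology L] in
/-- (Ported verbatim from the HodgeCMPerL package; no docstring in the source.) -/
theorem datum_rat : (datum E L m).rat = rat E L m := rfl
omit [FiniteDimensional ℝ E] [DiscreteTopology L] in
/-- (Ported verbatim from the HodgeCMPerL package; no docstring in the source.) -/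
theorem datum_theta : (datum E L m).theta = theta E L m := rfl

omit [FiniteDimensional ℝ E] [DiscreteTopology L] in
/-- **`ActionContinuous` (We64 n° 39) is a THEOREM of the model.** -/
theorem actionContinuous : (datum E L m).ActionContinuous :=
  continuous_act_uncurry E m

/-- **`ThetaContinuousInvariant` (We64 Théorème 6) is a THEOREM of the model.** -/
theorem thetaContinuousInvariant : (datum E L m).ThetaContinuousInvariant :=
  ⟨continuous_theta E L m, fun Φ _ hγ S => theta_rat_mul E L m Φ hγ S⟩

/-- **`dist_cont` (PRINT-DERIVED in `WeilThetaModel`) is a THEOREM of the model.** -/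
theorem dist_cont : Continuous fun Φ : (datum E L m).SX => (datum E L m).theta Φ 1 :=
  continuous_theta_left E L m 1

/-- The lattice `L` as a subgroup of `Multiplicative E` (`G_U(L⁺) ⊆ G_U(𝔸)` in the dictionary). -/
def latticeSubgroup : Subgroup (Multiplicative E) :=
  AddSubgroup.toSubgroup L.toAddSubgroup

omit [NormedSpace ℝ E] [FiniteDimensional ℝ E] [DiscreteTopology L] in
/-- (Ported verbatim from the HodgeCMPerL package; no docstring in the source.) -/
@[simp] theorem mem_latticeSubgroup (a : Multiplicative E) :
    a ∈ latticeSubgroup E L ↔ Multiplicative.toAdd a ∈ L := by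
  simp [latticeSubgroup]

/-- **The archimedean Schrödinger–lattice `WeilThetaModel`** for the pair
`(G_U, Γ_U; U(W), Γ) ↦ (Multiplicative E, L; Circle, Γ)` with `Γ` any subgroup of `m`-torsion phases:
every field of prl1-g4's record is a theorem / construction of this file — `W := datum`, `s := id`, `SK := univ`. -/
def schrodingerModel (Γ : Subgroup Circle) (hΓ : ∀ u ∈ Γ, u ^ m = 1) :
    HodgeCM.WeilThetaModel (Multiplicative E) (latticeSubgroup E L) Circle Γ where
  W := datum E L m
  act_one := act_one E m
  theta_act := theta_act E L m
  actionContinuous := actionContinuous E L m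
  thetaContinuousInvariant := thetaContinuousInvariant E L m
  dist_cont := dist_cont E L m
  s := MonoidHom.id (Multiplicative E × Circle)
  s_cont := continuous_id
  s_rat := fun γU hγU γ hγ => ⟨(mem_latticeSubgroup E L γU).1 hγU, hΓ γ hγ⟩
  SK := Set.univ
  SK_stable := fun _ _ _ => Set.mem_univ _

/-- The simplest choice `Γ = ⊥`. -/
def schrodingerModelBot : HodgeCM.WeilThetaModel (Multiplicative E) (latticeSubgroup E L) Circle ⊥ :=
  schrodingerModel E L m ⊥ fun u hu => by rw [Subgroup.mem_bot.1 hu, one_zpow]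

/-- (Ported verbatim from the HodgeCMPerL package; no docstring in the source.) -/
@[simp] theorem schrodingerModel_W (Γ : Subgroup Circle) (hΓ : ∀ u ∈ Γ, u ^ m = 1) :
    (schrodingerModel E L m Γ hΓ).W = datum E L m := rfl

/-- (Ported verbatim from the HodgeCMPerL package; no docstring in the source.) -/
@[simp] theorem schrodingerModel_SK (Γ : Subgroup Circle) (hΓ : ∀ u ∈ Γ, u ^ m = 1) :
    (schrodingerModel E L m Γ hΓ).SK = Set.univ := rfl

/-! ## 5. prl1-g4's structural laws, BY NAME, in the model -/

/-- **The three structural laws of the kernel-model theta carrier** (`omg_one`, `θ_cont`, `θ_omg` — prl1-g4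
`WeilThetaModel.structural_laws`) HOLD in the Schrödinger–lattice model: here `θ_Φ` is a genuine continuous function
on the torus `(E ⧸ L) × (U(1) ⧸ Γ)` and `ω(h)` is the weight-`m` character action. -/
theorem schrodingerModel_structural_laws (Γ : Subgroup Circle) (hΓ : ∀ u ∈ Γ, u ^ m = 1) :
    (∀ Φ : (schrodingerModel E L m Γ hΓ).SK, (schrodingerModel E L m Γ hΓ).omg 1 Φ = Φ) ∧
      Continuous (schrodingerModel E L m Γ hΓ).θ ∧
      ∀ (h : Circle) (Φ : (schrodingerModel E L m Γ hΓ).SK)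
        (ξ : Multiplicative E ⧸ latticeSubgroup E L) (q : Circle ⧸ Γ),
        (schrodingerModel E L m Γ hΓ).θ ((schrodingerModel E L m Γ hΓ).omg h Φ) (ξ, q) =
          (schrodingerModel E L m Γ hΓ).θ Φ (ξ, h⁻¹ • q) :=
  (schrodingerModel E L m Γ hΓ).structural_laws

/-- The model's theta kernel on representatives: `θ_Φ(aL, uΓ) = Θ_Φ((a, u)⁻¹) = u^{-m} · ∑_{v ∈ L} Φ (a + v)`. -/
theorem schrodingerModel_θ_mk (Γ : Subgroup Circle) (hΓ : ∀ u ∈ Γ, u ^ m = 1)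
    (Φ : 𝓢(E, ℂ)) (a : Multiplicative E) (u : Circle) :
    (schrodingerModel E L m Γ hΓ).θ ⟨Φ, Set.mem_univ Φ⟩ (QuotientGroup.mk a, QuotientGroup.mk u) =
      ((u : ℂ) ^ m)⁻¹ * ∑' v : L, Φ (Multiplicative.toAdd a + (v : E)) := by
  rw [WeilThetaModel.θ_mk]
  show theta E L m Φ ((a, u)⁻¹) = _
  rw [theta_eq]
  simp only [Prod.snd_inv, Prod.fst_inv, Circle.coe_inv, toAdd_inv, neg_neg, inv_zpow]

/-- Non-degeneracy survives the descent: some theta kernel of the model is non-zero (at the origin of the torus). -/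
theorem schrodingerModel_θ_ne_zero (Γ : Subgroup Circle) (hΓ : ∀ u ∈ Γ, u ^ m = 1) :
    ∃ Φ : (schrodingerModel E L m Γ hΓ).SK,
      (schrodingerModel E L m Γ hΓ).θ Φ (QuotientGroup.mk 1, QuotientGroup.mk 1) ≠ 0 := by
  obtain ⟨Φ, hΦ⟩ := exists_theta_one_eq_one E L m
  refine ⟨⟨Φ, Set.mem_univ _⟩, ?_⟩
  rw [WeilThetaModel.θ_mk]
  show theta E L m Φ ((1, 1)⁻¹) ≠ 0
  rw [show ((1 : Multiplicative E), (1 : Circle)) = 1 from rfl, inv_one, hΦ]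
  exact one_ne_zero

end SchwartzWeil
end HodgeCM

end
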